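import Summits.ABC.IUTFork.Joshi.DictionaryCollation
import Summits.ABC.IUTFork.Joshi.TestIsmScalingShells
import HarnessLib

/-!
# Block-E TEST note for D-10 (answer to E-t38 08:55:57Z): UNIT power moves of the W-collation, read on OUR containers, are REGION-FIXING
# ([J-III] = arXiv:2401.13508v4 Prop 9.7.5.1 / [ATS II½] Prop 7.5.1 reading W; E-t38's `ArithmeticoidCollationPowers` p433447)

Test file of the abc-iut cell, branch E (rung LADDER-ABC:A2.E; seat abc-iut-E-t18, D-10 writer). **No side is taken** on [IUTchIII] Cor. 3.12,
on Joshi's claims, or on Mochizuki's report on them; typed ≠ proved ≠ endorsed; located ≠ adjudicated. NO abc claim.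

CONTEXT. E-t38 (p433447, standard mathematics): under reading W of [ATS II½] Prop 7.5.1 («all the isomorphisms (of topological groups) of each
factor») every BIJECTIVE power map `x ↦ x^u` is an admissible collation identification, so the W-collation of the Kummer class of `q_v` contains
the classes of `q_v^u`, `p_v ∤ u` — «in particular `q_v^{j²}`»; E-t38 asks (E-cx / E-t18 to decide): a D-10 row sending W-moves into
`⟨Ind1 ∪ Ind2⟩` must make that group contain «`x ↦ x^u` on packet images of Kummer classes».
WHAT THE KERNEL SAYS HERE (our reading of the additive side; no new hypothesis). On OUR log-shell containers a Kummer class is read ADDITIVELY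
(tensor packets of `log(𝒟⊢_v)`), so the power map `x ↦ x^u` of the multiplicative class induces the SCALING `y ↦ u·y` of the container; for
`p ∤ u` this `u` is a `p`-ADIC UNIT. At the ℚ-line carriers of record (`lineShells A I`: abc-iut-w4-d101's `signShells`, E-t41's `scalShells`)
such a unit scaling, realised through a D-10/T-18 dictionary as a `placewiseFamily`, acts on the label-`j` packet by `u^{j+1}` — valuation `0`
— and therefore FIXES EVERY `p`-ADIC BALL `B_k` (`image_pBall_unitFamily`, from E-t41's `image_pBall_of_scalar`): it carries NO Θ-region `B_{j²}`
onto the q-region `B_1` (`unitFamily_not_carries`, `pBall_injective`), whatever `Ism` is. So: (i) a dictionary sending W's unit-power moves to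
unit scalings satisfies `CollationInIsm` wherever `Ism ∋` unit scalings (e.g. `scalShells`; and lattice-preserving unit scalings are the
isometric kind Dupuy–Hilado's `ismDH` admits) — (ii) but those moves are S-IRRELEVANT on the region level: X-06 in its simplest form (valuation-0
moves fix every hull-set). The reading under which «`q^{j²}` is a collation-translate of `q`» would bear on S is a RE-READING OF THE DATUM (which
packet region represents the class: valuation `1` vs `j²`), i.e. it lives in the seed's `datum` / `StandardPointIsQPilot` rows (X-08 shape, E-t2),
not in `MovesAreInd` / D-10. Located, not adjudicated. [claim: Joshi2024ATS3, status: disputed] [claim: Joshi2023ATS2half, status: disputed];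
our side [claim: Mochizuki2012, status: disputed]. Standard axioms only.
-/

noncomputable section

namespace Summit.ABC.IUTFork.Joshi.ATS3

open Function Set Thm311 Cor312 Cor312.Checks Cor312.IdentifiedNonVacuity Cor312Vol Cor312Vol.NaiveWitness Cor312Vol.PinnedWitness
  Joshi.IsmScaling

variable (p : ℕ) [hp : Fact p.Prime]

/-- **The unit move on the ℚ-line carriers**: multiplication by a nonzero rational `u` on every container line, realised on the packets as
T-18's label-uniform `placewiseFamily` (= how a D-10 `CollationDictionary` with `isoAut … := smulOfUnit u` realises a W-collation power move
`x ↦ x^u` read additively). DATA. [claim: Joshi2024ATS3, status: disputed] -/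
def unitFamily (A I : Set (ℚ ≃ₗ[ℚ] ℚ)) (hA : LinearEquiv.refl ℚ ℚ ∈ A) (hI : LinearEquiv.refl ℚ ℚ ∈ I) (u : ℚ) (hu : u ≠ 0) :
    (lineShells A I hA hI).PacketAut :=
  placewiseFamily (lineShells A I hA hI) fun _ => LinearEquiv.smulOfUnit (Units.mk0 u hu)

variable {A I : Set (ℚ ≃ₗ[ℚ] ℚ)} {hA : LinearEquiv.refl ℚ ℚ ∈ A} {hI : LinearEquiv.refl ℚ ℚ ∈ I}

omit hp in
/-- The unit move acts on the label-`j` packet (a `(j+1)`-fold tensor power of the line) as the scalar `u^{j+1}`. [folklore] -/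
theorem unitFamily_apply (u : ℚ) (hu : u ≠ 0) (j : toyIndex.Label) (vQ : toyIndex.VQ) (x : signShells.Packet j vQ) :
    unitFamily A I hA hI u hu j vQ x = (u ^ ((j : ℕ) + 1)) • x := by
  have h := factorwise_eq_smul j vQ (fun _ => (lineShells A I hA hI).summandwise vQ fun _ => LinearEquiv.smulOfUnit (Units.mk0 u hu))
    (fun _ => u) (fun i y => by funext v; rfl) x
  rw [Finset.prod_const, Finset.card_univ, Fintype.card_fin] at h
  exact h

omit hp in
/-- … i.e. it multiplies the line coordinate by `u^{j+1}`. [folklore] -/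
theorem line_unitFamily (u : ℚ) (hu : u ≠ 0) (j : toyIndex.Label) (vQ : toyIndex.VQ) (x : signShells.Packet j vQ) :
    line j vQ (unitFamily A I hA hI u hu j vQ x) = u ^ ((j : ℕ) + 1) * line j vQ x := by
  rw [unitFamily_apply, map_smul, smul_eq_mul]

/-- **A `p`-adic UNIT move FIXES EVERY BALL**: if `v_p(u) = 0` (e.g. `u` an integer prime to `p` — E-t38's `p ∤ u`), the unit move carries
`B_k` onto `B_k` at every label and place (E-t41's `image_pBall_of_scalar` with valuation `(j+1)·v_p(u) = 0`). [folklore] -/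
theorem image_pBall_unitFamily (u : ℚ) (hu : u ≠ 0) (hval : padicValRat p u = 0) (j : toyIndex.Label) (vQ : toyIndex.VQ) (k : ℤ) :
    unitFamily A I hA hI u hu j vQ '' pBall p j vQ k = pBall p j vQ k := by
  have h := image_pBall_of_scalar p (Φ := unitFamily A I hA hI u hu j vQ) (pow_ne_zero ((j : ℕ) + 1) hu)
    (fun x => line_unitFamily u hu j vQ x) k
  rw [padicValRat.pow, hval, mul_zero, add_zero] at h
  exact h

/-- **Hence a unit move carries NO ball onto a DIFFERENT ball** — in particular no Θ-region `B_{j²}` onto the q-region `B_1` for `j ≥ 2`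
(`pBall_injective`): W's unit-power collation moves, read on OUR containers, are S-IRRELEVANT at the region level, whatever `Ism` is.
Located, not adjudicated. [claim: Joshi2024ATS3, status: disputed] -/
theorem unitFamily_not_carries (u : ℚ) (hu : u ≠ 0) (hval : padicValRat p u = 0) (j : toyIndex.Label) (vQ : toyIndex.VQ)
    {k k' : ℤ} (hk : k ≠ k') : unitFamily A I hA hI u hu j vQ '' pBall p j vQ k ≠ pBall p j vQ k' := by
  rw [image_pBall_unitFamily p u hu hval]
  exact fun h => hk (pBall_injective p j vQ h)

/-- The Θ-region / q-region instance: at a label `j` with `j² ≠ 1` (i.e. `j ≥ 2`) a unit move does not carry `B_{j²}` onto `B_1`.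
[claim: Joshi2024ATS3, status: disputed] -/
theorem unitFamily_not_carries_theta_to_q (u : ℚ) (hu : u ≠ 0) (hval : padicValRat p u = 0) (j : toyIndex.Label) (vQ : toyIndex.VQ)
    (hj : jsq j ≠ 1) : unitFamily A I hA hI u hu j vQ '' pBall p j vQ (jsq j) ≠ pBall p j vQ 1 :=
  unitFamily_not_carries p u hu hval j vQ hj

omit hp in
/-- An integer prime to `p` has `p`-adic valuation `0` (E-t38's hypothesis `p ∤ u` in the form used above). [folklore] -/
theorem padicValRat_eq_zero_of_not_dvd {u : ℕ} (hu : ¬ p ∣ u) : padicValRat p (u : ℚ) = 0 := by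
  rw [padicValRat.of_nat, Nat.cast_eq_zero]
  exact padicValNat.eq_zero_of_not_dvd hu

omit hp in
/-- **(i) `CollationInIsm`-compatibility**: at the X-07′ carriers `scalShells` (Ism = univ) the unit move's container automorphisms lie in Ism,
trivially; more to the point, a unit scaling is LATTICE-PRESERVING (`image_pBall_unitFamily` at `k = 0`: the unit ball is fixed), i.e. of the
isometric kind an honest `Ism` admits — so W's unit-power moves do not even need an enlarged `Ism`. [claim: Joshi2024ATS3, status: disputed] -/
theorem unitFamily_mem_Ind2Family_scalShells (u : ℚ) (hu : u ≠ 0) :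
    unitFamily signs Set.univ (Set.mem_insert _ _) (Set.mem_univ _) u hu ∈ scalShells.Ind2Family :=
  placewiseFamily_mem_Ind2Family scalShells fun _ => Set.mem_univ _

end Summit.ABC.IUTFork.Joshi.ATS3

end
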